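import Mathlib
import Literature.Computability.Complexity.SymmetricCircuit
import Literature.Computability.Complexity.Classes
import Summits.PneNP.PneNP.Theorems.SymmetryBudgetWindowBarrierStubHeaderHardwiring
import Summits.PneNP.PneNP.Theorems.SymmetryBudgetWindowBarrierRelocation

/-!
# The pure square-symmetric core of stub `stub_symmetricIndistinguishability` (crux
`SymmetryBudget.WindowBarrier`, item stmt-PneNP-2145, line `canonical-form-completeness`)

The open stub S4 of the line asks, for every polynomial `p`, for infinitely many `m` and two
`m × m` matrices `x, y` whose graphs are not `Bud(m,⌊log₂ m⌋)`-isomorphic while every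
`Bud`-symmetric `tcBasis`-circuit of size `≤ p m` takes equal values on them. This file proves
that S4 FOLLOWS from its cleanest special case, a statement about SQUARE-SYMMETRIC circuits in
the sense of Dawar–Wilsenach (full symmetric group of a `g`-element vertex set acting diagonally
on the `g × g` adjacency inputs) of SIMPLY EXPONENTIAL size:

  (★) `CoreFooling`: for every `d`, for infinitely many `g`, there are two non-isomorphic simple
  graphs on `Fin g` on whose adjacency matrices every `Sym(Fin g)`-symmetric `tcBasis`-circuit
  with at most `2^{d g}` gates takes the same value.

`symmetricIndistinguishability_of_coreFooling : CoreFooling → S4` (S4 verbatim as registered).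
Proof: plant the two graphs on the free part of `m = 2^g` vertices (`⌊log₂ m⌋ = g`), all other
entries `0`. A `Bud`-isomorphism of the planted matrices restricts to an isomorphism of the
graphs. A `Bud(m,g)`-symmetric circuit `C` on `m × m` inputs of size `≤ p(2^g) ≤ 2^{dg} - 2`
becomes a `Sym(Fin g)`-symmetric circuit on `g × g` inputs of size `C.size + 2` with the same
values on the planted inputs, by HARD-WIRING every input outside the free block to the constant
`0` and renaming the free block (the type-changing form of the relocation calculus of
`SymmetryBudgetWindowBarrierStubHeaderHardwiring.lean`: the wiring `φ` sends `(n+j, n+j')` to the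
new input `(j, j')` and everything else to the constant gate; it intertwines `ρ × ρ` for the
extension `ρ = id ⊕ σ ∈ Bud` of any `σ ∈ Sym(Fin g)` with `σ × σ`, so every automorphism of `C`
over `ρ × ρ` lifts to one of the new circuit over `σ × σ`).

So the open content of S4 (and, through the line's composition, of the crux) is exactly an
exponential lower bound of INDISTINGUISHABILITY type for square-symmetric threshold circuits on
`g`-vertex graphs — the regime `size = 2^{Θ(g)}`, i.e. gate orbits in `(2^g, g!)`, one notch above
the support-theorem range `size < C(g, g/4)` (Dawar–Wilsenach, ToCL 2022 Thm 4.10 / ToC 2025 §6).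
-/

-- `Summit.PneNP.PneNP.…` duplicates `PneNP` BY DESIGN (single-problem summit).
set_option linter.dupNamespace false

namespace Summit.PneNP.PneNP.Theorems

open Literature.Computability.Complexity Literature.Computability.Complexity.GateList Filter
open scoped Classical

namespace CoreReduction

/-! ### Planting a `g`-vertex graph on the free part of `m = n + g` vertices

No definitions are introduced (kernel-only helper file): the free index `n + j`, the planted
matrix and the extension `id ⊕ σ` of a permutation of the free block are written as explicit
terms / obtained from existence lemmas with their specifications. -/

section Plant

variable {n g : ℕ}

/-- The free index `n + j` of `Fin (n + g)` (explicit term). -/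
theorem freeIdx_lt (n : ℕ) (j : Fin g) : n + (j : ℕ) < n + g := by omega

/-- Two free indices are equal iff the block indices are. -/
theorem freeIdx_inj (n : ℕ) {j j' : Fin g} :
    (⟨n + j, freeIdx_lt n j⟩ : Fin (n + g)) = ⟨n + j', freeIdx_lt n j'⟩ ↔ j = j' := by
  constructor
  · intro h
    simp only [Fin.mk.injEq] at h
    exact Fin.ext (by omega)
  · rintro rfl; rfl

/-- **The planted matrix** of a graph `G` on `Fin g`: adjacency of `G` on the free block
`{n, …, n+g-1}²`, `false` elsewhere (existence with specification). -/
theorem exists_plant (n : ℕ) (G : SimpleGraph (Fin g)) :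
    ∃ x : Fin (n + g) × Fin (n + g) → Bool,
      (∀ j j' : Fin g, x (⟨n + j, freeIdx_lt n j⟩, ⟨n + j', freeIdx_lt n j'⟩) = decide (G.Adj j j')) ∧
      (∀ q : Fin (n + g) × Fin (n + g), ¬ (n ≤ (q.1 : ℕ) ∧ n ≤ (q.2 : ℕ)) → x q = false) ∧
      ∀ q : Fin (n + g) × Fin (n + g), ∀ h : n ≤ (q.1 : ℕ) ∧ n ≤ (q.2 : ℕ),
        x q = decide (G.Adj ⟨q.1 - n, by omega⟩ ⟨q.2 - n, by omega⟩) := by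
  refine ⟨fun q => if h : n ≤ (q.1 : ℕ) ∧ n ≤ (q.2 : ℕ) then
      decide (G.Adj ⟨q.1 - n, by omega⟩ ⟨q.2 - n, by omega⟩) else false, ?_, ?_, ?_⟩
  · intro j j'
    dsimp only
    rw [dif_pos (by simp)]
    congr 2 <;> apply Fin.ext <;> simp
  · intro q h
    dsimp only
    rw [dif_neg h]
  · intro q h
    dsimp only
    rw [dif_pos h]

/-- **The extension `id ⊕ σ`** of a permutation `σ` of `Fin g` to `Fin (n + g)`: identity below
`n`, `n + j ↦ n + σ j` on the free block; it lies in the budget `Bud(n + g, g)` and preserves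
freeness of indices (existence with specification). -/
theorem exists_extendPerm (n : ℕ) (σ : Equiv.Perm (Fin g)) :
    ∃ ρ : Equiv.Perm (Fin (n + g)),
      (∀ i : Fin (n + g), (i : ℕ) < n → ρ i = i) ∧
      (∀ j : Fin g, ρ ⟨n + j, freeIdx_lt n j⟩ = ⟨n + σ j, freeIdx_lt n (σ j)⟩) ∧
      (∀ i : Fin (n + g), n ≤ ((ρ i : Fin (n + g)) : ℕ) ↔ n ≤ (i : ℕ)) ∧
      (∀ (i : Fin (n + g)) (h : n ≤ (i : ℕ)),
        ρ i = ⟨n + σ ⟨i - n, by omega⟩, freeIdx_lt n _⟩) ∧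
      ρ ∈ pointStabiliserBudget (n + g) g := by
  let f : Equiv.Perm (Fin g) → Fin (n + g) → Fin (n + g) := fun θ i =>
    if h : n ≤ (i : ℕ) then ⟨n + θ ⟨i - n, by omega⟩, freeIdx_lt n _⟩ else i
  have hf : ∀ (θ : Equiv.Perm (Fin g)) (i : Fin (n + g)), f θ.symm (f θ i) = i := by
    intro θ i
    by_cases h : n ≤ (i : ℕ)
    · have h1 : f θ i = ⟨n + θ ⟨i - n, by omega⟩, freeIdx_lt n _⟩ := dif_pos h
      rw [h1]
      have h2 : n ≤ ((⟨n + θ ⟨i - n, by omega⟩, freeIdx_lt n _⟩ : Fin (n + g)) : ℕ) := by simp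
      show (if h : _ then _ else _) = i
      rw [dif_pos h2]
      apply Fin.ext
      simp only [Nat.add_sub_cancel_left, Fin.eta, Equiv.symm_apply_apply]
      omega
    · have h1 : f θ i = i := dif_neg h
      rw [h1]
      exact dif_neg h
  let ρ : Equiv.Perm (Fin (n + g)) := ⟨f σ, f σ.symm, hf σ, fun i => by
    simpa only [Equiv.symm_symm] using hf σ.symm i⟩
  have hρ : ∀ i : Fin (n + g), ρ i = f σ i := fun _ => rfl
  have hlt : ∀ i : Fin (n + g), (i : ℕ) < n → ρ i = i := fun i hi => by
    rw [hρ]; exact dif_neg (by omega)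
  have hge : ∀ (i : Fin (n + g)) (h : n ≤ (i : ℕ)), ρ i = ⟨n + σ ⟨i - n, by omega⟩, freeIdx_lt n _⟩ :=
    fun i h => by rw [hρ]; exact dif_pos h
  refine ⟨ρ, hlt, ?_, ?_, hge, fun i hi => hlt i (by omega)⟩
  · intro j
    rw [hge _ (by simp)]
    apply Fin.ext
    simp
  · intro i
    by_cases h : n ≤ (i : ℕ)
    · rw [hge i h]; simp [h]
    · rw [hlt i (by omega)]

/-- **A `Bud`-isomorphism of planted matrices restricts to an isomorphism of the graphs.** -/
theorem iso_of_budIso (n : ℕ) (G₁ G₂ : SimpleGraph (Fin g))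
    (x₁ x₂ : Fin (n + g) × Fin (n + g) → Bool)
    (hx₁ : ∀ j j' : Fin g, x₁ (⟨n + j, freeIdx_lt n j⟩, ⟨n + j', freeIdx_lt n j'⟩) = decide (G₁.Adj j j'))
    (hx₂ : ∀ j j' : Fin g, x₂ (⟨n + j, freeIdx_lt n j⟩, ⟨n + j', freeIdx_lt n j'⟩) = decide (G₂.Adj j j'))
    (ρ : Equiv.Perm (Fin (n + g))) (hρ : ρ ∈ pointStabiliserBudget (n + g) g)
    (h : (SimpleGraph.fromRel fun u v => x₁ (ρ u, ρ v) = true) =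
      (SimpleGraph.fromRel fun u v => x₂ (u, v) = true)) :
    Nonempty (G₁ ≃g G₂) := by
  -- `ρ` fixes the ordered indices, hence maps free indices to free indices (both ways)
  have hfix : ∀ i : Fin (n + g), (i : ℕ) < n → ρ i = i := fun i hi => hρ i (by omega)
  have hfree : ∀ i : Fin (n + g), n ≤ (i : ℕ) → n ≤ ((ρ i : Fin (n+g)) : ℕ) := by
    intro i hi
    by_contra hlt
    have h1 : ρ (ρ i) = ρ i := hfix (ρ i) (by omega)
    have h2 : ρ i = i := ρ.injective h1
    rw [h2] at hlt
    exact hlt hi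
  have hfree' : ∀ i : Fin (n + g), n ≤ (i : ℕ) → n ≤ ((ρ.symm i : Fin (n+g)) : ℕ) := by
    intro i hi
    by_contra hlt
    have h1 : ρ (ρ.symm i) = ρ.symm i := hfix (ρ.symm i) (by omega)
    rw [Equiv.apply_symm_apply] at h1
    rw [h1] at hi
    exact hlt hi
  -- the restriction of `ρ` to the free block, as a permutation of `Fin g`
  let t : Fin g → Fin g := fun j => ⟨((ρ ⟨n + j, freeIdx_lt n j⟩ : Fin (n+g)) : ℕ) - n, by
    have := (ρ ⟨n + j, freeIdx_lt n j⟩).2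
    have := hfree ⟨n + j, freeIdx_lt n j⟩ (by simp); omega⟩
  let t' : Fin g → Fin g := fun j => ⟨((ρ.symm ⟨n + j, freeIdx_lt n j⟩ : Fin (n+g)) : ℕ) - n, by
    have := (ρ.symm ⟨n + j, freeIdx_lt n j⟩).2
    have := hfree' ⟨n + j, freeIdx_lt n j⟩ (by simp); omega⟩
  have ht : ∀ j : Fin g, ρ ⟨n + j, freeIdx_lt n j⟩ = ⟨n + t j, freeIdx_lt n (t j)⟩ := by
    intro j
    apply Fin.ext
    have hf := hfree ⟨n + j, freeIdx_lt n j⟩ (by simp)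
    simp [t]
    omega
  have ht' : ∀ j : Fin g, ρ.symm ⟨n + j, freeIdx_lt n j⟩ = ⟨n + t' j, freeIdx_lt n (t' j)⟩ := by
    intro j
    apply Fin.ext
    have hf := hfree' ⟨n + j, freeIdx_lt n j⟩ (by simp)
    simp [t']
    omega
  let τ : Equiv.Perm (Fin g) :=
    { toFun := t
      invFun := t'
      left_inv := fun j => by
        have h1 := ht' (t j)
        rw [← ht j, Equiv.symm_apply_apply] at h1
        exact ((freeIdx_inj n).1 h1).symm
      right_inv := fun j => by
        have h1 := ht (t' j)
        rw [← ht' j, Equiv.apply_symm_apply] at h1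
        exact ((freeIdx_inj n).1 h1).symm }
  have hτ : ∀ j : Fin g, ρ ⟨n + j, freeIdx_lt n j⟩ = ⟨n + τ j, freeIdx_lt n (τ j)⟩ := ht
  -- `τ` is an isomorphism `G₂ ≃g G₁`
  refine ⟨(⟨τ, ?_⟩ : G₂ ≃g G₁).symm⟩
  intro a b
  have key := congrArg (fun H : SimpleGraph (Fin (n + g)) =>
    H.Adj ⟨n + a, freeIdx_lt n a⟩ ⟨n + b, freeIdx_lt n b⟩) h
  simp only [SimpleGraph.fromRel_adj, hτ, hx₁, hx₂, decide_eq_true_eq, ne_eq, freeIdx_inj] at key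
  have key' := Iff.of_eq key
  constructor
  · intro hab
    have hne : a ≠ b := fun heq => by subst heq; exact G₁.irrefl hab
    have := (key'.1 ⟨hne, Or.inl hab⟩).2
    exact this.elim id fun h' => h'.symm
  · intro hab
    have hne : a ≠ b := fun heq => by subst heq; exact G₂.irrefl hab
    have := (key'.2 ⟨hne, Or.inl hab⟩).2
    exact this.elim id fun h' => h'.symm

/-- **The planting wiring.** `φ (n+j, n+j') = inl (j, j')` on the free block, the constant gate
`1` (value `false`, read off the prefix values `[true, false]`) elsewhere; it reads any planted
matrix off the adjacency matrix of its graph and intertwines `ρ × ρ`, for the extension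
`ρ = id ⊕ σ` of any `σ ∈ Sym(Fin g)`, with `σ × σ`. -/
theorem exists_plantWire (n g : ℕ) :
    ∃ φ : Fin (n + g) × Fin (n + g) → (Fin g × Fin g) ⊕ ℕ,
      WiresOK 2 φ ∧
      (∀ (G : SimpleGraph (Fin g)) (x : Fin (n + g) × Fin (n + g) → Bool),
        (∀ q : Fin (n + g) × Fin (n + g), ¬ (n ≤ (q.1 : ℕ) ∧ n ≤ (q.2 : ℕ)) → x q = false) →
        (∀ q : Fin (n + g) × Fin (n + g), ∀ h : n ≤ (q.1 : ℕ) ∧ n ≤ (q.2 : ℕ),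
          x q = decide (G.Adj ⟨q.1 - n, by omega⟩ ⟨q.2 - n, by omega⟩)) →
        ∀ q : Fin (n + g) × Fin (n + g),
          wireOf (fun p : Fin g × Fin g => decide (G.Adj p.1 p.2)) [true, false] (φ q) = x q) ∧
      ∀ (σ : Equiv.Perm (Fin g)) (ρ : Equiv.Perm (Fin (n + g))),
        (∀ i : Fin (n + g), n ≤ ((ρ i : Fin (n + g)) : ℕ) ↔ n ≤ (i : ℕ)) →
        (∀ (i : Fin (n + g)) (h : n ≤ (i : ℕ)), ρ i = ⟨n + σ ⟨i - n, by omega⟩, freeIdx_lt n _⟩) →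
        ∀ q : Fin (n + g) × Fin (n + g),
          φ (ρ q.1, ρ q.2) = Sum.map (fun p : Fin g × Fin g => (σ p.1, σ p.2)) id (φ q) := by
  refine ⟨fun q => if h : n ≤ (q.1 : ℕ) ∧ n ≤ (q.2 : ℕ) then
      Sum.inl (⟨q.1 - n, by omega⟩, ⟨q.2 - n, by omega⟩) else Sum.inr 1, ?_, ?_, ?_⟩
  · intro q k hk
    dsimp only at hk
    split_ifs at hk
    simp only [Sum.inr.injEq] at hk
    omega
  · intro G x hx0 hx1 q
    dsimp only
    by_cases h : n ≤ (q.1 : ℕ) ∧ n ≤ (q.2 : ℕ)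
    · rw [dif_pos h, wireOf_inl, hx1 q h]
    · rw [dif_neg h, wireOf_inr, hx0 q h]
      rfl
  · intro σ ρ hρfree hρval q
    dsimp only
    by_cases h : n ≤ (q.1 : ℕ) ∧ n ≤ (q.2 : ℕ)
    · have h' : n ≤ ((ρ q.1 : Fin (n+g)) : ℕ) ∧ n ≤ ((ρ q.2 : Fin (n+g)) : ℕ) :=
        ⟨(hρfree q.1).2 h.1, (hρfree q.2).2 h.2⟩
      rw [dif_pos h', dif_pos h]
      simp only [Sum.map_inl, Sum.inl.injEq, Prod.mk.injEq]
      constructor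
      · apply Fin.ext; simp [hρval q.1 h.1]
      · apply Fin.ext; simp [hρval q.2 h.2]
    · have h' : ¬ (n ≤ ((ρ q.1 : Fin (n+g)) : ℕ) ∧ n ≤ ((ρ q.2 : Fin (n+g)) : ℕ)) := by
        rw [hρfree, hρfree]; exact h
      rw [dif_neg h', dif_neg h]
      rfl

/-- **Circuit transfer.** A `Bud(n+g, g)`-symmetric `tcBasis`-circuit on `(n+g) × (n+g)` inputs
yields a `Sym(Fin g)`-symmetric (square-symmetric) `tcBasis`-circuit on `g × g` inputs with two
more gates which takes, on the adjacency matrix of any `G`, the value of the former on any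
planted matrix of `G`. -/
theorem exists_core_circuit (n g : ℕ) (C : Circuit (Fin (n + g) × Fin (n + g)))
    (hB : C.IsOver tcBasis) (hsym : C.IsSymmetricUnder (pointStabiliserBudget (n + g) g)) :
    ∃ D : Circuit (Fin g × Fin g), D.IsOver tcBasis ∧ D.size = C.size + 2 ∧
      D.IsSymmetricUnder Set.univ ∧
      ∀ (G : SimpleGraph (Fin g)) (x : Fin (n + g) × Fin (n + g) → Bool),
        (∀ q : Fin (n + g) × Fin (n + g), ¬ (n ≤ (q.1 : ℕ) ∧ n ≤ (q.2 : ℕ)) → x q = false) →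
        (∀ q : Fin (n + g) × Fin (n + g), ∀ h : n ≤ (q.1 : ℕ) ∧ n ≤ (q.2 : ℕ),
          x q = decide (G.Adj ⟨q.1 - n, by omega⟩ ⟨q.2 - n, by omega⟩)) →
        D.eval (fun p : Fin g × Fin g => decide (G.Adj p.1 p.2)) = C.eval x := by
  obtain ⟨φ, hφ2, hφv, hφσ⟩ := exists_plantWire n g
  obtain ⟨pre, hpreL, hpre0, hpreB, hpreV, hpreWF⟩ :=
    HeaderHardwiring.exists_constPre (Fin g × Fin g)
  have hφ : WiresOK pre.length φ := by rw [hpreL]; exact hφ2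
  obtain ⟨D, hDg, hDo⟩ := exists_hardwire₂ pre hpreWF C φ hφ
  refine ⟨D, isOver_hardwire₂ pre hpreB C D hB φ pre.length hDg, ?_, ?_, ?_⟩
  · rw [size_hardwire₂ pre C D φ pre.length hDg, hpreL]
  · intro σ _
    obtain ⟨ρ, -, -, hρfree, hρval, hρbud⟩ := exists_extendPerm n σ
    obtain ⟨τ, hτ⟩ := hsym ρ hρbud
    exact exists_isInducedAut_hardwire₂ pre hpre0 C D φ hφ hDg hDo
      (π := fun q : Fin (n + g) × Fin (n + g) => (ρ q.1, ρ q.2))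
      (π' := fun p : Fin g × Fin g => (σ p.1, σ p.2)) (fun q => hφσ σ ρ hρfree hρval q) hτ
  · intro G x hx0 hx1
    rw [eval_hardwire₂ pre C D φ hφ hDg hDo, hpreV]
    exact congrArg C.eval (funext fun q => hφv G x hx0 hx1 q)

end Plant

/-! ### Arithmetic: polynomials in `2^g` are `≤ 2^{d g}` -/

/-- Every `ℕ`-polynomial is eventually dominated, along `m = 2^g`, by `2^{d g} - 2` for a
suitable `d`. -/
theorem exists_pow_bound (p : Polynomial ℕ) :
    ∃ d g₀ : ℕ, ∀ g : ℕ, g₀ ≤ g → p.eval (2 ^ g) + 2 ≤ 2 ^ (d * g) := by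
  obtain ⟨c, k, hck⟩ := exists_eval_le_mul_pow_add p
  refine ⟨k + c + 3, 1, fun g hg => ?_⟩
  have h1 : p.eval (2 ^ g) ≤ c * (2 ^ g) ^ k + c := hck _
  have h2 : (2 : ℕ) ^ g ≥ 2 := by
    calc (2:ℕ) ^ g ≥ 2 ^ 1 := Nat.pow_le_pow_right (by norm_num) hg
      _ = 2 := by norm_num
  -- c * X^k + c + 2 ≤ X^(k + c + 2) for X ≥ 2
  have hc : c + 2 ≤ 2 ^ (c + 2) := (Nat.lt_two_pow_self).le
  have h3 : c ≤ (2 ^ g) ^ (c + 2) := by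
    calc c ≤ 2 ^ (c + 2) := by omega
      _ ≤ (2 ^ g) ^ (c + 2) := Nat.pow_le_pow_left h2 _
  have h4 : c * (2 ^ g) ^ k + c + 2 ≤ (2 ^ g) ^ (k + c + 3) := by
    have hXk : 1 ≤ (2 ^ g) ^ k := Nat.one_le_pow _ _ (by positivity)
    have hXc2 : c + 2 ≤ (2 ^ g) ^ (c + 2) := hc.trans (Nat.pow_le_pow_left h2 _)
    calc c * (2 ^ g) ^ k + c + 2 = c * (2 ^ g) ^ k + (c + 2) := by ring
      _ ≤ (2 ^ g) ^ (c + 2) * (2 ^ g) ^ k + (c + 2) * 1 := by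
          nlinarith
      _ ≤ (2 ^ g) ^ (c + 2) * (2 ^ g) ^ k + (2 ^ g) ^ (c + 2) * (2 ^ g) ^ k := by
          nlinarith
      _ = 2 * ((2 ^ g) ^ (c + 2) * (2 ^ g) ^ k) := by ring
      _ ≤ (2 ^ g) * ((2 ^ g) ^ (c + 2) * (2 ^ g) ^ k) := Nat.mul_le_mul_right _ h2
      _ = (2 ^ g) ^ (k + c + 3) := by ring
  calc p.eval (2 ^ g) + 2 ≤ c * (2 ^ g) ^ k + c + 2 := by omega
    _ ≤ (2 ^ g) ^ (k + c + 3) := h4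
    _ = 2 ^ ((k + c + 3) * g) := by rw [← pow_mul, Nat.mul_comm]

end CoreReduction

open CoreReduction

/-- **The pure square-symmetric core implies S4.** If for every `d`, for infinitely many `g`,
there are two non-isomorphic simple graphs on `Fin g` on whose adjacency matrices every
`Sym(Fin g)`-symmetric `tcBasis`-circuit with at most `2^{d g}` gates agrees (CoreFooling, (★)),
then the registered stub `stub_symmetricIndistinguishability` of line
`canonical-form-completeness` holds: for every polynomial `p`, infinitely often in `m`, two
`m × m` matrices with non-`Bud(m,⌊log₂ m⌋)`-isomorphic graphs fool every `Bud`-symmetric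
`tcBasis`-circuit of size `≤ p m` (take `m = 2^g` and plant the graphs on the free part).
The conclusion is VERBATIM the registered signature of the stub. -/
theorem symmetricIndistinguishability_of_coreFooling
    (hcore : ∀ d : ℕ, ∃ᶠ g in atTop, ∃ G₁ G₂ : SimpleGraph (Fin g),
      ¬ Nonempty (G₁ ≃g G₂) ∧
      ∀ C : Circuit (Fin g × Fin g), C.IsOver tcBasis → C.size ≤ 2 ^ (d * g) →
        C.IsSymmetricUnder Set.univ →
          C.eval (fun p : Fin g × Fin g => decide (G₁.Adj p.1 p.2)) =
            C.eval (fun p : Fin g × Fin g => decide (G₂.Adj p.1 p.2))) :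
    ∀ p : Polynomial ℕ, ∃ᶠ m in atTop, ∃ x y : Fin m × Fin m → Bool,
      (¬ ∃ ρ ∈ pointStabiliserBudget m (Nat.log 2 m),
          (SimpleGraph.fromRel fun u v => x (ρ u, ρ v) = true) =
            (SimpleGraph.fromRel fun u v => y (u, v) = true)) ∧
      ∀ C : Circuit (Fin m × Fin m), C.IsOver tcBasis → C.size ≤ p.eval m →
        C.IsSymmetricUnder (pointStabiliserBudget m (Nat.log 2 m)) → C.eval x = C.eval y := by
  intro p
  obtain ⟨d, g₀, hd⟩ := exists_pow_bound p
  rw [Filter.frequently_atTop]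
  intro a
  obtain ⟨g, hga, G₁, G₂, hniso, hfool⟩ :=
    (Filter.frequently_atTop.1 (hcore d)) (max a g₀)
  have hg₀ : g₀ ≤ g := le_of_max_le_right hga
  have hag : a ≤ g := le_of_max_le_left hga
  -- `m = 2^g = n + g`
  have hgle : g ≤ 2 ^ g := (Nat.lt_two_pow_self).le
  set n : ℕ := 2 ^ g - g with hn
  have hm : n + g = 2 ^ g := by omega
  have hlog : Nat.log 2 (n + g) = g := by rw [hm, Nat.log_pow (by norm_num)]
  obtain ⟨x₁, hx₁f, hx₁0, hx₁1⟩ := exists_plant n G₁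
  obtain ⟨x₂, hx₂f, hx₂0, hx₂1⟩ := exists_plant n G₂
  refine ⟨n + g, by omega, x₁, x₂, ?_, ?_⟩
  · rintro ⟨ρ, hρ, hiso⟩
    rw [hlog] at hρ
    exact hniso (iso_of_budIso n G₁ G₂ x₁ x₂ hx₁f hx₂f ρ hρ hiso)
  · intro C hB hsize hsym
    rw [hlog] at hsym
    obtain ⟨D, hDB, hDs, hDsym, hDev⟩ := exists_core_circuit n g C hB hsym
    have hDsize : D.size ≤ 2 ^ (d * g) := by
      rw [hDs]
      have := hd g hg₀
      rw [← hm] at this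
      omega
    have := hfool D hDB hDsize hDsym
    rwa [hDev G₁ x₁ hx₁0 hx₁1, hDev G₂ x₂ hx₂0 hx₂1] at this

/-- **Registered sub-goal `stub_coreReduction`** (crux stmt-PneNP-2145): S4 follows from the
pure square-symmetric core (★) — alias of `symmetricIndistinguishability_of_coreFooling`. -/
theorem stub_coreReduction : (∀ d : ℕ, ∃ᶠ g in atTop, ∃ G₁ G₂ : SimpleGraph (Fin g), ¬ Nonempty (G₁ ≃g G₂) ∧ ∀ C : Circuit (Fin g × Fin g), C.IsOver tcBasis → C.size ≤ 2 ^ (d * g) → C.IsSymmetricUnder Set.univ → C.eval (fun p : Fin g × Fin g => decide (G₁.Adj p.1 p.2)) = C.eval (fun p : Fin g × Fin g => decide (G₂.Adj p.1 p.2))) → ∀ p : Polynomial ℕ, ∃ᶠ m in atTop, ∃ x y : Fin m × Fin m → Bool, (¬ ∃ ρ ∈ pointStabiliserBudget m (Nat.log 2 m), (SimpleGraph.fromRel fun u v => x (ρ u, ρ v) = true) = (SimpleGraph.fromRel fun u v => y (u, v) = true)) ∧ ∀ C : Circuit (Fin m × Fin m), C.IsOver tcBasis → C.size ≤ p.eval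 m → C.IsSymmetricUnder (pointStabiliserBudget m (Nat.log 2 m)) → C.eval x = C.eval y :=
  symmetricIndistinguishability_of_coreFooling

end Summit.PneNP.PneNP.Theorems
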